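import Summits.BirchSwinnertonDyer.BirchSwinnertonDyer.Theses.QuadraticBranchSignedControl
import Summits.BirchSwinnertonDyer.BirchSwinnertonDyer.Theorems.QuadraticBranchSignedControlPlusKatoDivisibilityOfEulerSystemBoundRows
import Summits.BirchSwinnertonDyer.BirchSwinnertonDyer.Theorems.QuadraticBranchSignedControlPlusEtaNonsurjMuSaturation
import Literature.NumberTheory.EllipticCurves.Kato2004.ConditionVOfNotHasCMProofs
import HarnessLib

/-!
# K8 Kato side on the NON-CM rows whose `p`-adic tower is NOT onto: Kato's hypothesis (v) is now a
# THEOREM for every non-CM curve, so Kobayashi Thm. 4.1 / 2.2 at `η`, (RK⁺), and the integral upper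
# inclusion modulo `μ = 0` hold there BY NAME from `{hZ, h134(, h12)}`

Cell `bsd-potss` (HOME `run/shared/lean/pub/bsd-potss/`), seat `bsd-potss-k8q-c2x` g5 (prover; lane B of
the K8 Kato side, route `QuadraticBranchSignedControl`).  HONEST FRAMING: the programme assembles BSD for
analytic rank `≤ 1` strictly from published theorems and types the remainder; BSD is not proved by any of
this; every theorem below is CONDITIONAL on named Literature facts displayed as hypotheses — `hZ` =
`Kobayashi2003.thm62_63_73_etaColemanPoitouTate_zeta` (Kobayashi Thm. 6.2/6.3/7.3 i)/Cor. 7.2 at `η`, `z`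
a genuine Euler-system class), `h134` = `Kato2004.thm13_4_lengthAt_fineSelmerDual_le_of_isEulerSystemClass`
(Kato Thm. 13.4, reduction-free), `h12` = `Kobayashi2003.thm12_signedSelmerDual_finite_torsion` (Thm. 1.2)
— and, in §3, on the displayed `μ = 0` binder; nothing is closed or booked.

## What is new

Lane B (g2, p540932; g4, p553368) derived the Kato half at `η` from `{hZ, h134}` on every row where
Kato's hypothesis (v) for the twist `W = V^{(p*)}` holds, and discharged (v) ONLY on the tower-onto rows
(Kato (12.5.2)).  The seat's g5 Literature theorems `WeierstrassCurve.exists_congruenceSubgroup_le_of_not_hasCM`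
(the `p`-adic OPEN IMAGE theorem for non-CM curves at every `p`, Serre 1968 IV-11, proved in the kernel;
p559975) and `Kato2004.exists_finrank_coker_eq_one_quadraticTwist_primeStar_of_not_hasCM` make (v) a
THEOREM for every non-CM `V` — so the same kernel roads now run on the NON-CM rows whose tower is NOT
onto (`Im ρ̄_{V,p} = C_ns⁺(p)`; 28 pairs in-table at `p = 5`, the non-CM half of crux 19606
`PlusEtaMainConjectureNonsurj`), where Kato (12.5.2) fails (`EulerSystemBigImageBarrier`):

* §1 `KatoSideNonCM.quadraticBranchPlusKatoDivisibilityAt_of_facts_of_not_hasCM` — (RK⁺)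
  `QuadraticBranchPlusKatoDivisibilityAt V p` for EVERY non-CM Gss2 twist `V` (`p ≥ 5`, good, `a_p = 0`),
  onto or not, from `{hZ, h134, h12}`; `plusKatoDivisibilityBranch_nonCM_of_facts` — the aside decl
  `PlusKatoDivisibilityBranch` (item 21377, ex-19241) RESTRICTED to the non-CM rows, from the same three
  facts (its CM rows are Kato Thm. 12.5 via §15, not 13.4 — not claimed).
* §2 `KatoSideNonCM.etaKatoDivisibility_nonCM_of_zeta_of_thm13_4` — Kobayashi Thm. 2.2 (`+`) and Thm. 4.1
  (first display, RATIONAL clause; integral clause under tower-onto) at `η` on the cell's `η`-datum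
  `EtaSignedSelmerDualData`, for every non-CM row, from `{hZ, h134}` — the row-level replacement of the
  cites `h22` / `h41` in the 19606 compositions on the non-CM rows.
* §3 `KatoSideNonCM.etaUpperIntegral_nonCM_of_zeta_of_thm13_4_of_mu` — the INTEGRAL upper inclusion
  `(L_p⁺(V,η,X)) ⊆ Char(X⁺(V/K_∞)^η)` on every non-CM row GIVEN `μ(X⁺(V/K_∞)^η) = 0` (unit content of a
  characteristic generator), from `{hZ, h134}` and Gauss' lemma (k8eta-c2 g2's `μ`-saturation, p472046,
  re-run on the row-level input) — VERBATIM the conclusion `EtaUpperIntegralAt V p` of the registered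
  stub `stub_etaMC_nonCM_upper` of crux 19606, now modulo `μ = 0` with NO Kobayashi-theorem cite.

References: [Kobayashi2003] Thm. 1.2, 2.2, 4.1, 6.2–6.3, Cor. 7.2, Thm. 7.3, last sentence of §7
(pp. 2–13); [Kato2004Asterisque] Thm. 13.4 and the remark on (v) (p. 226), (12.8.2) (p. 223);
[SerreAbelianLadic1968] IV-11; [Washington1997] §13.1 (Gauss for `p ∈ Λ`).
-/

noncomputable section

-- justification: the `Summit.BirchSwinnertonDyer.BirchSwinnertonDyer.…` path repeats a component (route-file convention)
set_option linter.dupNamespace false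

open scoped Classical

open CongruenceSubgroup Field WeierstrassCurve
open Literature.NumberTheory.EllipticCurves
open Literature.NumberTheory.EllipticCurves.ModularForms
open Literature.NumberTheory.GaloisRepresentations
open Literature.NumberTheory.EllipticCurves.GreenbergVatsal2000
open Summit.BirchSwinnertonDyer.Rank1Residual.Additive hiding EtaSignedSelmerDualData
open Summit.BirchSwinnertonDyer.Rank1Residual.Additive.SignedTwist
open Summit.BirchSwinnertonDyer.BirchSwinnertonDyer.Theses.QuadraticBranchSignedControl

namespace Summit.BirchSwinnertonDyer.BirchSwinnertonDyer.Theorems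

namespace KatoSideNonCM

variable {p : ℕ} [Fact p.Prime]

/-! ## §1 (RK⁺) on every non-CM Gss2 row from `{hZ, h134, h12}` -/

/-- **(RK⁺) `QuadraticBranchPlusKatoDivisibilityAt V p` for EVERY non-CM Gss2 twist**, onto or not: for
`V/ℚ` globally minimal WITHOUT complex multiplication, `p ≥ 5` good with `a_p(V) = 0`, granted `hZ`,
`h134`, `h12`.  Lane B's row theorem `EulerSystemBound.quadraticBranchPlusKatoDivisibilityAt_of_zeta_of_thm13_4_of_thm12`
(g2) with its ROW hypothesis — Kato's (v) for `V^{(p*)}` — DISCHARGED by the open-image theorem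
(`Kato2004.exists_finrank_coker_eq_one_quadraticTwist_primeStar_of_not_hasCM`).  CONDITIONAL on the
three named facts; closes nothing. [cite: Kobayashi2003, Thm. 1.2 (p. 2), Thm. 4.1 (p. 8), last sentence of §7 (p. 13)]
[cite: Kato2004Asterisque, Thm. 13.4 and the remark on (v) (p. 226)] -/
theorem quadraticBranchPlusKatoDivisibilityAt_of_facts_of_not_hasCM
    (hZ : Kobayashi2003.thm62_63_73_etaColemanPoitouTate_zeta)
    (h134 : Kato2004.thm13_4_lengthAt_fineSelmerDual_le_of_isEulerSystemClass)
    (h12 : Kobayashi2003.thm12_signedSelmerDual_finite_torsion)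
    (V : WeierstrassCurve ℚ) [V.IsElliptic] [V.IsGloballyMinimal] (hp5 : 5 ≤ p)
    (hgood : V.HasGoodReductionAtPrime p) (hap : V.frobeniusTrace p = 0) (hV : ¬ V.HasCM) :
    QuadraticBranchPlusKatoDivisibilityAt V p :=
  EulerSystemBound.quadraticBranchPlusKatoDivisibilityAt_of_zeta_of_thm13_4_of_thm12 hZ h134 h12 V hp5
    hgood hap
    (Kato2004.exists_finrank_coker_eq_one_quadraticTwist_primeStar_of_not_hasCM (by omega) V hV)

/-- **The aside decl `PlusKatoDivisibilityBranch` (item 21377, the reading (RK⁺) of ex-item 19241)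
RESTRICTED TO THE NON-CM ROWS, from three named facts**: for every globally minimal `V/ℚ` without
complex multiplication, `p ≥ 5` good with `a_p = 0`, `QuadraticBranchPlusKatoDivisibilityAt V p`.  (The CM
rows of 21377 are NOT claimed: there Kato's (v) fails and the printed road is Kato Thm. 12.5 via §15 /
Rubin.)  CONDITIONAL; closes nothing. [cite: Kato2004Asterisque, Thm. 13.4 and the remark on (v) (p. 226)]
[cite: Kobayashi2003, Thm. 4.1 (p. 8)] -/
theorem plusKatoDivisibilityBranch_nonCM_of_facts
    (hZ : Kobayashi2003.thm62_63_73_etaColemanPoitouTate_zeta)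
    (h134 : Kato2004.thm13_4_lengthAt_fineSelmerDual_le_of_isEulerSystemClass)
    (h12 : Kobayashi2003.thm12_signedSelmerDual_finite_torsion) :
    ∀ (V : WeierstrassCurve ℚ) [V.IsElliptic] [V.IsGloballyMinimal] (p : ℕ) [Fact p.Prime],
      5 ≤ p → V.HasGoodReductionAtPrime p → V.frobeniusTrace p = 0 → ¬ V.HasCM →
        QuadraticBranchPlusKatoDivisibilityAt V p :=
  fun V _ _ _ _ hp5 hgood hap hV =>
    quadraticBranchPlusKatoDivisibilityAt_of_facts_of_not_hasCM hZ h134 h12 V hp5 hgood hap hV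

/-! ## §2 Kobayashi Thm. 2.2 (`+`) / Thm. 4.1 at `η` on every non-CM row from `{hZ, h134}` -/

/-- **Kobayashi Thm. 2.2 (sign `+`) and Thm. 4.1 (first display: RATIONAL clause always, INTEGRAL clause
under tower-onto) at the quadratic `η`, on the cell's `η`-datum, for EVERY non-CM row** — `V/ℚ` globally
minimal without CM, `p` odd good with `a_p = 0`, newform `f`, normalised period `ϖ`, plus `L`-function
`Lη`, cyclotomic `(κ, γ)` in `Gal(ℚ̄/K₀)`, and ANY `D : EtaSignedSelmerDualData V κ K₀ ℚ_[p] ηq γ 1`: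
`X(D)` is finitely generated torsion, `∃ n, pⁿ·Lη ∈ Char X(D)`, and `Lη ∈ Char X(D)` if `ρ̄_{V,p^m}` is
onto for all `m`.  Lane B's `EulerSystemBound.etaKatoDivisibility_of_zeta_of_thm13_4` (g2) on the
Literature promotion copy of `D`, its row hypothesis (v) discharged by
`Kato2004.exists_finrank_coker_eq_one_quadraticTwist_primeStar_of_not_hasCM`.  CONDITIONAL on `hZ`,
`h134`; replaces the cites `h22` / `h41` of the crux-19606 compositions on the non-CM rows.
[cite: Kobayashi2003, Thm. 2.2 (p. 5), Thm. 4.1 (p. 8), proof of Thm. 7.4 and last sentence of §7 (p. 13)]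
[cite: Kato2004Asterisque, Thm. 13.4 and the remark on (v) (p. 226)] -/
theorem etaKatoDivisibility_nonCM_of_zeta_of_thm13_4
    (hZ : Kobayashi2003.thm62_63_73_etaColemanPoitouTate_zeta)
    (h134 : Kato2004.thm13_4_lengthAt_fineSelmerDual_le_of_isEulerSystemClass)
    (K₀ : Type) [Field K₀] [NumberField K₀] [IsCyclotomicExtension {p} ℚ K₀]
    [(galRange (K := ℚ) K₀).Normal] (ηq : absoluteGaloisGroup ℚ →* ℤˣ)
    (hηK : ∀ σ ∈ galRange (K := ℚ) K₀, ηq σ = 1) (hη1 : ηq ≠ 1)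
    (V : WeierstrassCurve ℚ) [V.IsElliptic] [V.IsGloballyMinimal] (hV : ¬ V.HasCM)
    {N : ℕ} [NeZero N] {f : CuspForm (Gamma0 N) 2} (hp2 : p ≠ 2)
    (hgood : V.HasGoodReductionAtPrime p) (hap : V.frobeniusTrace p = 0) (hf : IsNewformOf V f)
    (ϖ : ℚ) (hϖ : if Even (p / 2) then (ϖ : ℝ) * V.realPeriodRat = plusPeriod f
      else (ϖ : ℝ) * V.imaginaryPeriodRat = minusPeriod f)
    (Lη : IwasawaAlgebra p) (hL : IsQuadraticBranchPlusLFunction f p ϖ Lη)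
    (κ : ZpExtension ℚ p) (γ : absoluteGaloisGroup ℚ) (hκ : κ.IsCyclotomic) (hγ : κ.IsTopGenerator γ)
    (hγK : γ ∈ galRange (K := ℚ) K₀) (hγc : IsCyclotomicVariable p γ)
    (D : Summit.BirchSwinnertonDyer.Rank1Residual.Additive.EtaSignedSelmerDualData V κ K₀ ℚ_[p] ηq γ 1) :
    Module.Finite (IwasawaAlgebra p) D.X ∧ Module.IsTorsion (IwasawaAlgebra p) D.X ∧
      (∃ n : ℕ, (p : IwasawaAlgebra p) ^ n * Lη ∈ D.charIdeal) ∧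
      ((∀ m : ℕ, V.HasSurjectiveModNGaloisRep (p ^ m : ℕ)) → Lη ∈ D.charIdeal) := by
  -- the Literature promotion copy of the `η`-datum (field by field; `Char` agrees definitionally)
  let D' : Kobayashi2003.EtaSignedSelmerDualData V κ K₀ ℚ_[p] ηq γ 1 :=
    { X := D.X
      conj_mem := D.conj_mem
      toDual := D.toDual
      bijective := D.bijective
      toDual_T_smul := D.toDual_T_smul
      toDual_C_smul := D.toDual_C_smul }
  exact EulerSystemBound.etaKatoDivisibility_of_zeta_of_thm13_4 hZ h134 K₀ ηq hηK hη1 V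
    (Kato2004.exists_finrank_coker_eq_one_quadraticTwist_primeStar_of_not_hasCM hp2 V hV)
    hp2 hgood hap hf ϖ hϖ Lη hL κ γ hκ hγ hγK hγc D'

/-! ## §3 The INTEGRAL upper inclusion at `η` on every non-CM row, modulo `μ = 0` -/

/-- **`stub_etaMC_nonCM_upper` of crux 19606 modulo `μ(X⁺(V/K_∞)^η) = 0`, Kato side BY NAME.**  For
`V/ℚ` globally minimal WITHOUT complex multiplication (any image: onto or not) and `p` prime, granted
`hZ`, `h134` and the displayed binder `hμ` (every characteristic generator of every `η`-signed plus dual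
datum has UNIT CONTENT — Greenberg–Vatsal's reading of `μ = 0`, verbatim `EtaMuZeroAt V p` of the 19606
skeleton): on the binders of (C1⁺_η) — `K₀ ⊇ ℚ(ζ_p)`, `ηq` even non-trivial, `p ≠ 2`, `V` good at `p`
with `a_p = 0`, newform `f`, period `ϖ`, plus `L`-function `Lη`, cyclotomic `(κ, γ)`, ANY datum `D` —
`(Lη) ⊆ Char X(D)`, i.e. VERBATIM `EtaUpperIntegralAt V p`.  Proof: §2 gives `pⁿ·Lη ∈ Char X(D)`; a
generator `g` of `Char` has unit content by `hμ`, so `g ∣ pⁿ Lη ⟹ g ∣ Lη` (Gauss for the prime `p ∈ Λ`,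
`Additive.dvd_of_dvd_C_pow_mul_of_hasUnitContent`) — k8eta-c2 g2's `μ`-saturation
(`EtaMuSaturation.etaUpperIntegral_of_hasUnitContent`) with the cites `h22`/`h41` replaced by `{hZ, h134}`.
CONDITIONAL on `hZ`, `h134`, `hμ`; closes nothing. [cite: Kobayashi2003, Thm. 4.1 first display (p. 8)]
[cite: Kato2004Asterisque, Thm. 13.4 (p. 226)] [cite: GreenbergVatsal2000, p. 2 (2)] [cite: Washington1997, §13.1] -/
theorem etaUpperIntegral_nonCM_of_zeta_of_thm13_4_of_mu
    (hZ : Kobayashi2003.thm62_63_73_etaColemanPoitouTate_zeta)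
    (h134 : Kato2004.thm13_4_lengthAt_fineSelmerDual_le_of_isEulerSystemClass)
    (V : WeierstrassCurve ℚ) [V.IsElliptic] [V.IsGloballyMinimal] (hV : ¬ V.HasCM)
    (hμ : ∀ (K₀ : Type) [Field K₀] [NumberField K₀] [IsCyclotomicExtension {p} ℚ K₀]
        [(galRange (K := ℚ) K₀).Normal] (ηq : absoluteGaloisGroup ℚ →* ℤˣ),
        (∀ σ ∈ galRange (K := ℚ) K₀, ηq σ = 1) → ηq ≠ 1 →
      ∀ (κ : ZpExtension ℚ p) (γ : absoluteGaloisGroup ℚ),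
        κ.IsCyclotomic → κ.IsTopGenerator γ → γ ∈ galRange (K := ℚ) K₀ →
      ∀ (D : Summit.BirchSwinnertonDyer.Rank1Residual.Additive.EtaSignedSelmerDualData V κ K₀ ℚ_[p] ηq γ 1)
        (g : IwasawaAlgebra p), D.charIdeal = Ideal.span {g} → HasUnitContent g) :
    ∀ (K₀ : Type) [Field K₀] [NumberField K₀] [IsCyclotomicExtension {p} ℚ K₀]
        [(galRange (K := ℚ) K₀).Normal] (ηq : absoluteGaloisGroup ℚ →* ℤˣ),
        (∀ σ ∈ galRange (K := ℚ) K₀, ηq σ = 1) → ηq ≠ 1 →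
      ∀ {N : ℕ} [NeZero N] {f : CuspForm (Gamma0 N) 2},
        p ≠ 2 → V.HasGoodReductionAtPrime p → V.frobeniusTrace p = 0 → IsNewformOf V f →
      ∀ (ϖ : ℚ), (if Even (p / 2) then (ϖ : ℝ) * V.realPeriodRat = plusPeriod f
          else (ϖ : ℝ) * V.imaginaryPeriodRat = minusPeriod f) →
      ∀ (Lη : IwasawaAlgebra p), IsQuadraticBranchPlusLFunction f p ϖ Lη →
      ∀ (κ : ZpExtension ℚ p) (γ : absoluteGaloisGroup ℚ),
        κ.IsCyclotomic → κ.IsTopGenerator γ → γ ∈ galRange (K := ℚ) K₀ → IsCyclotomicVariable p γ →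
      ∀ (D : Summit.BirchSwinnertonDyer.Rank1Residual.Additive.EtaSignedSelmerDualData V κ K₀ ℚ_[p] ηq γ 1),
        Ideal.span {Lη} ≤ D.charIdeal := by
  intro K₀ _ _ _ _ ηq hηK hη1 N _ f hp2 hgood hap hf ϖ hϖ Lη hL κ γ hκ hγ hγK hγc D
  -- Thm. 4.1 at `η`, rational clause, from `{hZ, h134}` and the open image (§2)
  obtain ⟨-, -, ⟨n, hn⟩, -⟩ := etaKatoDivisibility_nonCM_of_zeta_of_thm13_4 hZ h134 K₀ ηq hηK hη1 V hV
    hp2 hgood hap hf ϖ hϖ Lη hL κ γ hκ hγ hγK hγc D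
  -- a generator of `Char(X⁺(V/K_∞)^η)` (`Λ` a UFD), of unit content by `hμ`
  haveI : D.charIdeal.IsPrincipal := charIdeal_isPrincipal_holds p D.X
  obtain ⟨g, hg⟩ := Submodule.IsPrincipal.principal D.charIdeal
  have hg' : D.charIdeal = Ideal.span {g} := hg
  have hu : HasUnitContent g := hμ K₀ ηq hηK hη1 κ γ hκ hγ hγK D g hg'
  -- `g ∣ pⁿ·Lη`, hence `g ∣ Lη` (Gauss)
  rw [hg', Ideal.mem_span_singleton] at hn
  have hC : ((p : IwasawaAlgebra p) ^ n : IwasawaAlgebra p) = PowerSeries.C ((p : ℤ_[p]) ^ n) := by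
    rw [map_pow, map_natCast]
  rw [hC] at hn
  have hdvd : g ∣ Lη := dvd_of_dvd_C_pow_mul_of_hasUnitContent hu n hn
  rw [hg']
  exact Ideal.span_singleton_le_span_singleton.mpr hdvd

/-- **The 19606 stub shape**: `stub_etaMC_nonCM_upper` (the INTEGRAL Kato-side inclusion at `η` on the
non-CM Gss2 twists whose `p`-adic tower is NOT onto) FOLLOWS from `{hZ, h134}` and `μ(X⁺(V/K_∞)^η) = 0` on
those rows (`hμ`, the skeleton's `EtaMuZeroAt V p` row by row) — the non-onto hypothesis is not even used.
So on its non-CM rows crux 19606's Kato half IS «`μ = 0`» over the K8 trust base `{hZ, h134}` (no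
Kobayashi 2.2η/4.1η cite, no image hypothesis).  CONDITIONAL; closes nothing.
[cite: Kato2004Asterisque, Thm. 13.4 and the remark on (v) (p. 226)] [cite: Kobayashi2003, Thm. 4.1 (p. 8)]
[cite: GreenbergVatsal2000, p. 2 (2)] -/
theorem stub_etaMC_nonCM_upper_of_zeta_of_thm13_4_of_mu
    (hZ : Kobayashi2003.thm62_63_73_etaColemanPoitouTate_zeta)
    (h134 : Kato2004.thm13_4_lengthAt_fineSelmerDual_le_of_isEulerSystemClass)
    (hμ : ∀ (V : WeierstrassCurve ℚ) [V.IsElliptic] [V.IsGloballyMinimal] (p : ℕ) [Fact p.Prime],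
      5 ≤ p → V.HasGoodReductionAtPrime p → V.frobeniusTrace p = 0 →
      ¬ (∀ m : ℕ, V.HasSurjectiveModNGaloisRep (p ^ m : ℕ)) → ¬ V.HasCM →
      ∀ (K₀ : Type) [Field K₀] [NumberField K₀] [IsCyclotomicExtension {p} ℚ K₀]
          [(galRange (K := ℚ) K₀).Normal] (ηq : absoluteGaloisGroup ℚ →* ℤˣ),
          (∀ σ ∈ galRange (K := ℚ) K₀, ηq σ = 1) → ηq ≠ 1 →
        ∀ (κ : ZpExtension ℚ p) (γ : absoluteGaloisGroup ℚ),
          κ.IsCyclotomic → κ.IsTopGenerator γ → γ ∈ galRange (K := ℚ) K₀ →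
        ∀ (D : Summit.BirchSwinnertonDyer.Rank1Residual.Additive.EtaSignedSelmerDualData V κ K₀ ℚ_[p] ηq γ 1)
          (g : IwasawaAlgebra p), D.charIdeal = Ideal.span {g} → HasUnitContent g) :
    ∀ (V : WeierstrassCurve ℚ) [V.IsElliptic] [V.IsGloballyMinimal] (p : ℕ) [Fact p.Prime],
      5 ≤ p → V.HasGoodReductionAtPrime p → V.frobeniusTrace p = 0 →
      ¬ (∀ m : ℕ, V.HasSurjectiveModNGaloisRep (p ^ m : ℕ)) → ¬ V.HasCM →
      ∀ (K₀ : Type) [Field K₀] [NumberField K₀] [IsCyclotomicExtension {p} ℚ K₀]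
          [(galRange (K := ℚ) K₀).Normal] (ηq : absoluteGaloisGroup ℚ →* ℤˣ),
          (∀ σ ∈ galRange (K := ℚ) K₀, ηq σ = 1) → ηq ≠ 1 →
        ∀ {N : ℕ} [NeZero N] {f : CuspForm (Gamma0 N) 2},
          p ≠ 2 → V.HasGoodReductionAtPrime p → V.frobeniusTrace p = 0 → IsNewformOf V f →
        ∀ (ϖ : ℚ), (if Even (p / 2) then (ϖ : ℝ) * V.realPeriodRat = plusPeriod f
            else (ϖ : ℝ) * V.imaginaryPeriodRat = minusPeriod f) →
        ∀ (Lη : IwasawaAlgebra p), IsQuadraticBranchPlusLFunction f p ϖ Lη →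
        ∀ (κ : ZpExtension ℚ p) (γ : absoluteGaloisGroup ℚ),
          κ.IsCyclotomic → κ.IsTopGenerator γ → γ ∈ galRange (K := ℚ) K₀ → IsCyclotomicVariable p γ →
        ∀ (D : Summit.BirchSwinnertonDyer.Rank1Residual.Additive.EtaSignedSelmerDualData V κ K₀ ℚ_[p] ηq γ 1),
          Ideal.span {Lη} ≤ D.charIdeal :=
  fun V _ _ p _ hp5 hgood hap hns hV =>
    etaUpperIntegral_nonCM_of_zeta_of_thm13_4_of_mu hZ h134 V hV
      (hμ V p hp5 hgood hap hns hV)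

end KatoSideNonCM

end Summit.BirchSwinnertonDyer.BirchSwinnertonDyer.Theorems

end
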